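import Literature.Probability.Percolation.KozmaNitzanPreFKG
import Literature.Probability.Percolation.PercolationEvents
import Literature.Probability.LatticeModels.ProdBernoulliIndependence
import HarnessLib

/-!
# Crux `PercNearOneGluing.AdditiveGluing` (stmt-CriticalPhenomena-4576): the LOCALISED union bound (AG-loc) for two relays

Support file (`--supports stmt-CriticalPhenomena-4576`, lead-of-record prim-png-lead-4576 gen 6).  No named facts, no sorries,
no definitions.

(AG-loc) is the designation-free strengthening of Kozma–Nitzan's Conjecture 1 in which the union bound charges ONLY the relays
that the observer's cluster actually contains:
  `μ(o ↔ A, o ↮ b) ≤ Σ_{∅ ≠ S ⊆ A} μ(C(o) ∩ A = S) · max_{a ∈ S} μ(a ↮ b)`,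
equivalently `μ(o ↔ b, o ↔ A) ≥ E[min_{a ∈ A ∩ C(o)} μ(a ↔ b); o ↔ A]` (for `|A| = 1` this is Harris' inequality; it implies
Conjecture 1 and hence the crux `AdditiveGluing` for that `A`).  THIS FILE PROVES IT FOR `|A| = 2`:

* `AGloc.agloc_pair` — for `μ(a₁ ↔ b) ≤ μ(a₂ ↔ b)`:
  `μ(o ↔ a₁)·μ(a₁ ↔ b) + μ(o ↔ a₂, o ↮ a₁)·μ(a₂ ↔ b) ≤ μ(o ↔ b, o ↔ {a₁, a₂})`;
* `AGloc.agloc_pair_compl` — the same in the 'failure' form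
  `μ(o ↔ {a₁,a₂}, o ↮ b) ≤ μ(o ↔ a₁)·μ(a₁ ↮ b) + μ(o ↔ a₂, o ↮ a₁)·μ(a₂ ↮ b)`.

Proof: Kozma–Nitzan's "BHK four times" (arXiv:2401.12397, Thm. 1, pp. 7–8; the tree's `KNPreFKG.preFKG_pair` ingredients
`bhk_one_upper_upper` / `bhk_two_upper_upper`) gives, with `D = {a₁ ↮ a₂}`, `x_i = μ(D ∩ {o ↔ a_i})`,
`E = {o ↔ b} ∩ {o ↔ A}`, `F_i = {o ↔ A} ∩ {a_i ↔ b}`, the weighted form (their (6)) `(x₁ + x₂)·μ(E) ≥ x₁·μ(F₁) + x₂·μ(F₂)`;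
Harris gives `μ(F_i) ≥ μ(o ↔ A)·μ(a_i ↔ b)`; and `x₂ ≥ μ(o ↔ a₂, o ↮ a₁)`, `x₁ ≤ μ(o ↔ a₁)` turn the weights into the claim
(the degenerate case `x₁ + x₂ = 0` is Harris for `{o ↔ a₁}`, `{a₁ ↔ b}`).  An exact degree-3 sum-of-products certificate for the same
inequality (kit j069643, 30 BHK/Harris row-times-atom products, verified in rational arithmetic) is recorded in the lead's memo
LeadMath-g6 §6; censuses of (AG-loc) for `|A| ≥ 3`: ttrl2 requests.jsonl l.397.
[cite: KozmaNitzan2024, Thm. 1 (pp. 7–8)] [cite: VandenbergHaggstromKahn2005, Thms. 1.3–1.5 (pp. 6–8)]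
-/

noncomputable section

namespace Summit.CriticalPhenomena.PercolationContinuityZ3.Theorems.AGloc

open MeasureTheory Set
open Literature.Probability.LatticeModels (prodBernoulli prodBernoulli_harris)
open Literature.Probability.Percolation Literature.Probability.Percolation.KNPreFKG

variable {V : Type*} [Fintype V]

/-- Harris for the observer and one relay: `μ(o ↔ a)·μ(a ↔ b) ≤ μ(o ↔ b, o ↔ a)` (the `|A| = 1` case of (AG-loc)).
[cite: KozmaNitzan2024, §2.1 (p. 5, FKG/Harris)] -/
theorem agloc_single (w : Sym2 V → unitInterval) (o b a : V) :
    (prodBernoulli w).real (openConn o a) * (prodBernoulli w).real (openConn a b) ≤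
      (prodBernoulli w).real (openConn o b ∩ openConn o a : Set (BondConfig V)) := by
  classical
  have hup : ∀ x y : V, IsUpperSet (openConn x y : Set (BondConfig V)) := fun x y => isUpperSet_openConn x y
  have h := prodBernoulli_harris w (hup o a) (hup a b) (Set.toFinite _).measurableSet (Set.toFinite _).measurableSet
  have hset : (openConn o a ∩ openConn a b : Set (BondConfig V)) = openConn o b ∩ openConn o a := by
    ext ω
    simp only [mem_inter_iff, openConn, mem_setOf_eq]
    constructor
    · rintro ⟨h1, h2⟩; exact ⟨h1.trans h2, h1⟩
    · rintro ⟨h1, h2⟩; exact ⟨h2, h2.symm.trans h1⟩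
  rw [hset] at h
  exact h

/-- **(AG-loc) for two relays.**  If `μ(a₁ ↔ b) ≤ μ(a₂ ↔ b)` then
`μ(o ↔ a₁)·μ(a₁ ↔ b) + μ(o ↔ a₂, o ↮ a₁)·μ(a₂ ↔ b) ≤ μ(o ↔ b, o ↔ {a₁,a₂})`: attributing the observer to the LEAST reliable
relay of its own cluster and pretending independence UNDER-estimates the probability that the cluster reaches `b`.
Kozma–Nitzan's weighted inequality (6) ("BHK four times") + Harris + `μ(D ∩ {o↔a₂}) ≥ μ(o ↔ a₂, o ↮ a₁)`.
[cite: KozmaNitzan2024, Thm. 1 (pp. 7–8)] -/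
theorem agloc_pair (w : Sym2 V → unitInterval) (o b a₁ a₂ : V)
    (hτ : (prodBernoulli w).real (openConn a₁ b) ≤ (prodBernoulli w).real (openConn a₂ b)) :
    (prodBernoulli w).real (openConn o a₁) * (prodBernoulli w).real (openConn a₁ b) +
        (prodBernoulli w).real (openConn o a₂ ∩ (openConn o a₁)ᶜ : Set (BondConfig V)) *
          (prodBernoulli w).real (openConn a₂ b) ≤
      (prodBernoulli w).real (openConn o b ∩ (openConn o a₁ ∪ openConn o a₂) : Set (BondConfig V)) := by
  classical
  set μ := prodBernoulli w with hμ
  set O₁ : Set (BondConfig V) := openConn o a₁ with hO₁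
  set O₂ : Set (BondConfig V) := openConn o a₂ with hO₂
  set Ob : Set (BondConfig V) := openConn o b with hOb
  set B₁ : Set (BondConfig V) := openConn a₁ b with hB₁
  set B₂ : Set (BondConfig V) := openConn a₂ b with hB₂
  set D : Set (BondConfig V) := {ω | ¬ (openGraph ω).Reachable a₁ a₂} with hD
  set E : Set (BondConfig V) := Ob ∩ (O₁ ∪ O₂) with hE
  set F₁ : Set (BondConfig V) := (O₁ ∪ O₂) ∩ B₁ with hF₁
  set F₂ : Set (BondConfig V) := (O₁ ∪ O₂) ∩ B₂ with hF₂
  have hmeas : ∀ S : Set (BondConfig V), MeasurableSet S := fun S => (Set.toFinite S).measurableSet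
  have hup : ∀ x y : V, IsUpperSet (openConn x y : Set (BondConfig V)) := fun x y => isUpperSet_openConn x y
  have hsplit : ∀ A S : Set (BondConfig V), μ.real A = μ.real (A ∩ S) + μ.real (A ∩ Sᶜ) := by
    intro A S
    rw [← measureReal_inter_add_sdiff (s := A) (hmeas S), Set.sdiff_eq]
  -- the single-relay bound `μ(O₁)·μ(B₁) ≤ μ(E)` (Harris), used in the degenerate case
  have hE_O1 : μ.real O₁ * μ.real B₁ ≤ μ.real E := by
    have h1 := agloc_single w o b a₁
    rw [← hμ, ← hO₁, ← hB₁, ← hOb] at h1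
    refine h1.trans (measureReal_mono ?_)
    rintro ω ⟨hb, h1⟩
    exact ⟨hb, Or.inl h1⟩
  -- `O₂ ∖ O₁ ⊆ D ∩ O₂` and `D ∩ O₁ ⊆ O₁`
  have hx2 : μ.real (O₂ ∩ O₁ᶜ) ≤ μ.real (D ∩ O₂) := by
    refine measureReal_mono ?_
    rintro ω ⟨h2, hn1⟩
    refine ⟨?_, h2⟩
    simp only [hD, mem_setOf_eq]
    intro h12
    simp only [hO₁, hO₂, openConn, mem_setOf_eq, mem_compl_iff] at h2 hn1
    exact hn1 (h2.trans h12.symm)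
  have hx1 : μ.real (D ∩ O₁) ≤ μ.real O₁ := measureReal_mono inter_subset_right
  have hU : μ.real (O₁ ∪ O₂) = μ.real O₁ + μ.real (O₂ ∩ O₁ᶜ) := by
    rw [hsplit (O₁ ∪ O₂) O₁]
    congr 1
    · rw [inter_eq_right.2 subset_union_left]
    · congr 1
      ext ω
      simp only [mem_inter_iff, mem_union, mem_compl_iff]
      tauto
  -- Harris for `F_i`
  have hF1 : μ.real (O₁ ∪ O₂) * μ.real B₁ ≤ μ.real F₁ :=
    prodBernoulli_harris w ((hup o a₁).union (hup o a₂)) (hup a₁ b) (hmeas _) (hmeas _)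
  have hF2 : μ.real (O₁ ∪ O₂) * μ.real B₂ ≤ μ.real F₂ :=
    prodBernoulli_harris w ((hup o a₁).union (hup o a₂)) (hup a₂ b) (hmeas _) (hmeas _)
  have hn := fun (S : Set (BondConfig V)) => (measureReal_nonneg : 0 ≤ μ.real S)
  by_cases h12 : a₁ = a₂
  · -- a single relay: `O₂ = O₁`
    subst h12
    have h0 : μ.real (O₂ ∩ O₁ᶜ) = 0 := by
      rw [show O₂ ∩ O₁ᶜ = (∅ : Set (BondConfig V)) by rw [hO₁, hO₂]; exact inter_compl_self _]
      simp
    rw [h0, zero_mul, add_zero]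
    exact hE_O1
  -- the two "subtract the common event" identities (as in `KNPreFKG.preFKG_pair`)
  have hE1 : E ∩ O₁ = F₁ ∩ O₁ := by
    ext ω
    simp only [mem_inter_iff, mem_union, hE, hF₁, hO₁, hO₂, hOb, hB₁, openConn, mem_setOf_eq]
    constructor
    · rintro ⟨⟨hb, _⟩, h1⟩
      exact ⟨⟨Or.inl h1, h1.symm.trans hb⟩, h1⟩
    · rintro ⟨⟨_, hb⟩, h1⟩
      exact ⟨⟨h1.trans hb, Or.inl h1⟩, h1⟩
  have hE1c : E ∩ O₁ᶜ = O₂ ∩ B₂ ∩ D := by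
    ext ω
    simp only [mem_inter_iff, mem_union, mem_compl_iff, hE, hO₁, hO₂, hOb, hB₂, hD, openConn,
      mem_setOf_eq]
    constructor
    · rintro ⟨⟨hb, h1 | h2⟩, hn1⟩
      · exact absurd h1 hn1
      · exact ⟨⟨h2, h2.symm.trans hb⟩, fun h => hn1 (h2.trans h.symm)⟩
    · rintro ⟨⟨h2, hb⟩, hn⟩
      exact ⟨⟨h2.trans hb, Or.inr h2⟩, fun h1 => hn (h1.symm.trans h2)⟩
  have hF1c : F₁ ∩ O₁ᶜ = O₂ ∩ B₁ ∩ D := by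
    ext ω
    simp only [mem_inter_iff, mem_union, mem_compl_iff, hF₁, hO₁, hO₂, hB₁, hD, openConn,
      mem_setOf_eq]
    constructor
    · rintro ⟨⟨h1 | h2, hb⟩, hn1⟩
      · exact absurd h1 hn1
      · exact ⟨⟨h2, hb⟩, fun h => hn1 (h2.trans h.symm)⟩
    · rintro ⟨⟨h2, hb⟩, hn⟩
      exact ⟨⟨Or.inr h2, hb⟩, fun h1 => hn (h1.symm.trans h2)⟩
  have hE2 : E ∩ O₂ = F₂ ∩ O₂ := by
    ext ω
    simp only [mem_inter_iff, mem_union, hE, hF₂, hO₁, hO₂, hOb, hB₂, openConn, mem_setOf_eq]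
    constructor
    · rintro ⟨⟨hb, _⟩, h2⟩
      exact ⟨⟨Or.inr h2, h2.symm.trans hb⟩, h2⟩
    · rintro ⟨⟨_, hb⟩, h2⟩
      exact ⟨⟨h2.trans hb, Or.inr h2⟩, h2⟩
  have hE2c : E ∩ O₂ᶜ = O₁ ∩ B₁ ∩ D := by
    ext ω
    simp only [mem_inter_iff, mem_union, mem_compl_iff, hE, hO₁, hO₂, hOb, hB₁, hD, openConn,
      mem_setOf_eq]
    constructor
    · rintro ⟨⟨hb, h1 | h2⟩, hn2⟩
      · exact ⟨⟨h1, h1.symm.trans hb⟩, fun h => hn2 (h1.trans h)⟩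
      · exact absurd h2 hn2
    · rintro ⟨⟨h1, hb⟩, hn⟩
      exact ⟨⟨h1.trans hb, Or.inl h1⟩, fun h2 => hn (h1.symm.trans h2)⟩
  have hF2c : F₂ ∩ O₂ᶜ = O₁ ∩ B₂ ∩ D := by
    ext ω
    simp only [mem_inter_iff, mem_union, mem_compl_iff, hF₂, hO₁, hO₂, hB₂, hD, openConn,
      mem_setOf_eq]
    constructor
    · rintro ⟨⟨h1 | h2, hb⟩, hn2⟩
      · exact ⟨⟨h1, hb⟩, fun h => hn2 (h1.trans h)⟩
      · exact absurd h2 hn2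
    · rintro ⟨⟨h1, hb⟩, hn⟩
      exact ⟨⟨Or.inl h1, hb⟩, fun h2 => hn (h1.symm.trans h2)⟩
  have hdiff1 : μ.real E - μ.real F₁ = μ.real (O₂ ∩ B₂ ∩ D) - μ.real (O₂ ∩ B₁ ∩ D) := by
    rw [hsplit E O₁, hsplit F₁ O₁, hE1, hE1c, hF1c]
    ring
  have hdiff2 : μ.real E - μ.real F₂ = μ.real (O₁ ∩ B₁ ∩ D) - μ.real (O₁ ∩ B₂ ∩ D) := by
    rw [hsplit E O₂, hsplit F₂ O₂, hE2, hE2c, hF2c]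
    ring
  -- "Applying BHK 4 times", given `D = {a₁ ↮ a₂}` (verbatim from `KNPreFKG.preFKG_pair`)
  have hD1 : {ω : BondConfig V | ∀ x ∈ ({a₂} : Set V), ¬ (openGraph ω).Reachable a₁ x} = D := by
    ext ω
    simp [hD]
  have hD2 : {ω : BondConfig V | ∀ x ∈ ({a₁} : Set V), ¬ (openGraph ω).Reachable a₂ x} = D := by
    ext ω
    simp only [mem_setOf_eq, mem_singleton_iff, forall_eq, hD]
    exact not_congr ⟨SimpleGraph.Reachable.symm, SimpleGraph.Reachable.symm⟩
  have hD3 : {ω : BondConfig V | ¬ (openGraph ω).Reachable a₂ a₁} = D := by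
    ext ω
    simp only [mem_setOf_eq, hD]
    exact not_congr ⟨SimpleGraph.Reachable.symm, SimpleGraph.Reachable.symm⟩
  have h_i := bhk_one_upper_upper w a₂ ({a₁} : Set V) (by simpa using Ne.symm h12)
    (isUpperSet_connFamily a₂ o) (isUpperSet_connFamily a₂ b)
  rw [hD2, ← openConn_eq_setOf_connFamily, ← openConn_eq_setOf_connFamily, openConn_symm a₂ o] at h_i
  have h_ii := bhk_two_upper_upper w a₂ a₁ (Ne.symm h12) (isUpperSet_connFamily a₂ o)
    (isUpperSet_connFamily a₁ b)
  rw [hD3, ← openConn_eq_setOf_connFamily, ← openConn_eq_setOf_connFamily, openConn_symm a₂ o] at h_ii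
  have h_iii := bhk_one_upper_upper w a₁ ({a₂} : Set V) (by simpa using h12)
    (isUpperSet_connFamily a₁ o) (isUpperSet_connFamily a₁ b)
  rw [hD1, ← openConn_eq_setOf_connFamily, ← openConn_eq_setOf_connFamily, openConn_symm a₁ o] at h_iii
  have h_iv := bhk_two_upper_upper w a₁ a₂ h12 (isUpperSet_connFamily a₁ o)
    (isUpperSet_connFamily a₂ b)
  rw [← openConn_eq_setOf_connFamily, ← openConn_eq_setOf_connFamily, openConn_symm a₁ o] at h_iv
  have e1 : D ∩ (O₂ ∩ B₂) = O₂ ∩ B₂ ∩ D := inter_comm _ _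
  have e2 : D ∩ (O₂ ∩ B₁) = O₂ ∩ B₁ ∩ D := inter_comm _ _
  have e3 : D ∩ (O₁ ∩ B₁) = O₁ ∩ B₁ ∩ D := inter_comm _ _
  have e4 : D ∩ (O₁ ∩ B₂) = O₁ ∩ B₂ ∩ D := inter_comm _ _
  simp only [← hD, ← hO₁, ← hO₂, ← hB₁, ← hB₂] at h_i h_ii h_iii h_iv
  rw [e1] at h_i
  rw [e2] at h_ii
  rw [e3] at h_iii
  rw [e4] at h_iv
  -- KN's one-sided bounds: `μ(D)·(μE − μF₁) ≥ x₂·(μ(D∩B₂) − μ(D∩B₁))`, `μ(D)·(μE − μF₂) ≥ x₁·(μ(D∩B₁) − μ(D∩B₂))`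
  have key1 : μ.real D * (μ.real E - μ.real F₁) ≥
      μ.real (D ∩ O₂) * (μ.real (D ∩ B₂) - μ.real (D ∩ B₁)) := by
    rw [hdiff1, mul_sub, mul_sub]
    linarith [h_i, h_ii]
  have key2 : μ.real D * (μ.real E - μ.real F₂) ≥
      μ.real (D ∩ O₁) * (μ.real (D ∩ B₁) - μ.real (D ∩ B₂)) := by
    rw [hdiff2, mul_sub, mul_sub]
    linarith [h_iii, h_iv]
  -- the weighted form (6): `μ(D)·[x₁(μE − μF₁) + x₂(μE − μF₂)] ≥ 0`
  have key6 : μ.real D * (μ.real (D ∩ O₁) * (μ.real E - μ.real F₁) +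
      μ.real (D ∩ O₂) * (μ.real E - μ.real F₂)) ≥ 0 := by
    have hx1n := hn (D ∩ O₁)
    have hx2n := hn (D ∩ O₂)
    nlinarith [mul_le_mul_of_nonneg_left key1 hx1n, mul_le_mul_of_nonneg_left key2 hx2n]
  by_cases hx : μ.real (D ∩ O₁) + μ.real (D ∩ O₂) = 0
  · -- degenerate: `μ(O₂ ∖ O₁) = 0`, the claim is Harris for `O₁`, `B₁`
    have hx2z : μ.real (D ∩ O₂) = 0 := by linarith [hn (D ∩ O₁), hn (D ∩ O₂)]
    have h0 : μ.real (O₂ ∩ O₁ᶜ) = 0 := le_antisymm (hx2.trans hx2z.le) (hn _)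
    rw [h0, zero_mul, add_zero]
    exact hE_O1
  · have hxpos : 0 < μ.real (D ∩ O₁) + μ.real (D ∩ O₂) := lt_of_le_of_ne (by positivity) (Ne.symm hx)
    have hDpos : 0 < μ.real D := by
      have : μ.real (D ∩ O₁) ≤ μ.real D := measureReal_mono inter_subset_left
      have : μ.real (D ∩ O₂) ≤ μ.real D := measureReal_mono inter_subset_left
      linarith
    have h6 : μ.real (D ∩ O₁) * (μ.real E - μ.real F₁) + μ.real (D ∩ O₂) * (μ.real E - μ.real F₂) ≥ 0 := by
      by_contra hneg
      have := mul_neg_of_pos_of_neg hDpos (lt_of_not_ge hneg)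
      linarith [key6]
    -- combine with Harris for `F_i`, `x₂ ≥ μ(O₂ ∖ O₁)`, `x₁ ≤ μ(O₁)` and `τ₁ ≤ τ₂`
    have hprod : μ.real (O₂ ∩ O₁ᶜ) * μ.real (D ∩ O₁) ≤ μ.real (D ∩ O₂) * μ.real O₁ :=
      mul_le_mul hx2 hx1 (hn _) (hn _)
    have hτ' : 0 ≤ μ.real B₂ - μ.real B₁ := by linarith [hτ]
    have hgoal : (μ.real (D ∩ O₁) + μ.real (D ∩ O₂)) *
        (μ.real E - (μ.real O₁ * μ.real B₁ + μ.real (O₂ ∩ O₁ᶜ) * μ.real B₂)) ≥ 0 := by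
      have hA : μ.real (D ∩ O₁) * μ.real F₁ ≥ μ.real (D ∩ O₁) * (μ.real (O₁ ∪ O₂) * μ.real B₁) :=
        mul_le_mul_of_nonneg_left hF1 (hn _)
      have hB : μ.real (D ∩ O₂) * μ.real F₂ ≥ μ.real (D ∩ O₂) * (μ.real (O₁ ∪ O₂) * μ.real B₂) :=
        mul_le_mul_of_nonneg_left hF2 (hn _)
      rw [hU] at hA hB
      nlinarith [h6, hA, hB, mul_le_mul_of_nonneg_left hprod hτ', hn O₁, hn (O₂ ∩ O₁ᶜ), hn B₁, hn B₂]
    by_contra hlt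
    have : (μ.real (D ∩ O₁) + μ.real (D ∩ O₂)) *
        (μ.real E - (μ.real O₁ * μ.real B₁ + μ.real (O₂ ∩ O₁ᶜ) * μ.real B₂)) < 0 :=
      mul_neg_of_pos_of_neg hxpos (by linarith [lt_of_not_ge hlt])
    linarith [hgoal]

/-- **(AG-loc) for two relays, failure form.**  If `μ(a₁ ↔ b) ≤ μ(a₂ ↔ b)` then
`μ(o ↔ {a₁,a₂}, o ↮ b) ≤ μ(o ↔ a₁)·μ(a₁ ↮ b) + μ(o ↔ a₂, o ↮ a₁)·μ(a₂ ↮ b)` — the union bound charging only the relays in the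
observer's cluster (for `S = C(o) ∩ A`: `max_{a ∈ S} μ(a ↮ b)` is `μ(a₁ ↮ b)` if `a₁ ∈ S`, else `μ(a₂ ↮ b)`).
[cite: KozmaNitzan2024, Thm. 1 (pp. 7–8)] -/
theorem agloc_pair_compl (w : Sym2 V → unitInterval) (o b a₁ a₂ : V)
    (hτ : (prodBernoulli w).real (openConn a₁ b) ≤ (prodBernoulli w).real (openConn a₂ b)) :
    (prodBernoulli w).real ((openConn o a₁ ∪ openConn o a₂) ∩ (openConn o b)ᶜ : Set (BondConfig V)) ≤
      (prodBernoulli w).real (openConn o a₁) * (1 - (prodBernoulli w).real (openConn a₁ b)) +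
        (prodBernoulli w).real (openConn o a₂ ∩ (openConn o a₁)ᶜ : Set (BondConfig V)) *
          (1 - (prodBernoulli w).real (openConn a₂ b)) := by
  classical
  have h := agloc_pair w o b a₁ a₂ hτ
  have hmeas : ∀ S : Set (BondConfig V), MeasurableSet S := fun S => (Set.toFinite S).measurableSet
  have hsplit : ∀ A S : Set (BondConfig V), (prodBernoulli w).real A =
      (prodBernoulli w).real (A ∩ S) + (prodBernoulli w).real (A ∩ Sᶜ) := by
    intro A S
    rw [← measureReal_inter_add_sdiff (s := A) (hmeas S), Set.sdiff_eq]
  have hU : (prodBernoulli w).real (openConn o a₁ ∪ openConn o a₂ : Set (BondConfig V)) =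
      (prodBernoulli w).real (openConn o a₁) +
        (prodBernoulli w).real (openConn o a₂ ∩ (openConn o a₁)ᶜ : Set (BondConfig V)) := by
    rw [hsplit (openConn o a₁ ∪ openConn o a₂) (openConn o a₁)]
    congr 1
    · rw [inter_eq_right.2 subset_union_left]
    · congr 1
      ext ω
      simp only [mem_inter_iff, mem_union, mem_compl_iff]
      tauto
  have hAsplit := hsplit (openConn o a₁ ∪ openConn o a₂) (openConn o b)
  rw [show ((openConn o a₁ ∪ openConn o a₂) ∩ openConn o b : Set (BondConfig V)) =
      openConn o b ∩ (openConn o a₁ ∪ openConn o a₂) from inter_comm _ _] at hAsplit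
  nlinarith [h, hU, hAsplit]

end Summit.CriticalPhenomena.PercolationContinuityZ3.Theorems.AGloc

end
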